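import Mathlib.LinearAlgebra.Matrix.Charpoly.Coeff
import Mathlib.RingTheory.Valuation.Basic
import HarnessLib

/-!
# F0 · P3c · line LH6 «StCharTS» — road (D) «DEEP-FL», brick D1 «SHELL-VAL»: the characteristic polynomial of `k₁ · diag(d) · k₂` for `k₁, k₂ ≡ 1 (mod r)`
# over a valued commutative ring — coefficients congruent to those of `diag(d)` to RELATIVE precision `r`, and their EXACT valuations on a contracting shell

Cell `pub/hodgecm-mathlib`, crux H413 = `stmt-HodgeConjecture-24833` (`--supports` lane, helper), route HCCMUnconditional; seat LH6-p04 (g2).  Road (D)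
«DEEP-FL» of memo `F0/P3b/LH6-p04/g0/MEMO-XIG-B4.LH6p04g0.md` §3 = the in-house discharge of the residual hypothesis «XIG» of organs (S-i)∕(S-ii) of the leaf
`Cruxes/H413/Lines/F0_P3c_StCharTSPaydown.lean` (LH6-p02 (g0) B6 `stNoncuspidalMember_of_XIG`, 2026-09-02): CHOOSE the transfer of the shell indicator
`𝟙_{K_n b K_n}`, `b = z·aᵐ` on the contracting ray, and verify the matching of orbital integrals class by class.  Step XIG-1 of the memo, in the form road (D)
actually uses («SHELL-VAL», this seat 2026-09-02T04:1xZ): NO eigenvalue is extracted; only the VALUATIONS of the characteristic-polynomial COEFFICIENTS on the shell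
are needed (to see that a shell element is conjugate to no element of a compact-mod-centre torus, and to read `Δ‴` at the diagonal representatives).
THEOREMS ONLY (generic linear algebra over a commutative ring `R` with a valuation `v : Valuation R Γ₀`; Mathlib only), sorry-free, no definition ∕ instance ∕
notation ∕ named fact.  HONEST LABEL: HC_CM is proved only modulo the 7 printed citations (2 remaining: hLiu418 = stmt-HodgeConjecture-24832, h413 =
stmt-HodgeConjecture-24833) until rung 0 closes; count-neutral; nothing about `U(3)` is asserted here.

THE MATHEMATICS (folklore p-adic linear algebra; [Rogawski1990, §12.7 L. 12.7.3 proof p. 195 «let `γ = d(α, β, ᾱ⁻¹)`, `‖α‖ < 1`»; [Casselman1995, §1.4–1.5]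
for the shells `K aᵐ K`).  `k ≡ 1 (mod r)` means `v(k_{ij} − δ_{ij}) ≤ r` for all `i, j` (`r ≤ 1`).
* §1 ultrametric bookkeeping: products and DETERMINANTS are `1`-Lipschitz entrywise (`valuation_prod_sub_prod_le`, `valuation_det_sub_det_le`); `k ≡ 1` is
  stable under products and principal submatrices, and gives `v(det k − 1) ≤ r` (`valuation_det_sub_one_le_of_near_one`).
* §2 for `x = diag(d) · k`: every principal minor is `(∏_{i ∈ s} d_i) · det(k_{s,s})` (`det_submatrix_diagonal_mul`), hence
  `v(det x_{s,s} − ∏_{i∈s} d_i) ≤ r · ∏_{i∈s} v(d_i)` (`valuation_principalMinor_sub_le`) and, through Mathlib's `charpoly_coeff_eq_sum_minors`, the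
  coefficient of `X^{n−j}` of `charpoly x` is within `r · M_j` of that of `charpoly (diag d)` whenever `M_j` bounds the `j`-fold products `∏_{i∈s} v(d_i)`
  (`valuation_charpoly_coeff_sub_le`); two-sided shells `k₁ · diag(d) · k₂` reduce to this by `charpoly (A B) = charpoly (B A)` (`charpoly_mul_diagonal_mul`).
* §3 the rank-3 contracting shell: for `v(d₀) < v(d₁) < v(d₂)` and `r < 1` the three coefficients of `charpoly (k₁ · diag(d) · k₂)` have the EXACT valuations
  `v(d₂)`, `v(d₁ d₂)`, `v(d₀ d₁ d₂)` (`valuation_charpoly_coeff_shell_three`) — the invariant that separates the shell `K_n z aᵐ K_n` (`z` central unitary,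
  `a = d(ϖ, 1, σϖ⁻¹)`, `m ≥ 1`: pattern `(q^{−m}, 1, q^{m})`) from every class meeting a compact-mod-centre Cartan subgroup (all eigenvalue valuations equal).

## References
* [Rogawski1990] J. D. Rogawski, *Automorphic Representations of Unitary Groups in Three Variables*, Ann. of Math. Stud. 123 (1990): §12.7 L. 12.7.3 (proof)
  p. 195; §4.9 p. 55 (`τ(γ) = μ(α)` on `d(α, β, ᾱ⁻¹)`); §1.10 p. 9.
* [Casselman1995] W. Casselman, *Introduction to the theory of admissible representations of p-adic reductive groups* (1995 notes), Prop. 1.4.4, §1.5.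
-/

set_option autoImplicit false
-- the mandated namespace has the single-problem summit's repeated segment (`HodgeConjecture.HodgeConjecture`)
set_option linter.dupNamespace false

open Matrix Polynomial Finset
open scoped BigOperators

namespace Summit.HodgeConjecture.HodgeConjecture.Cruxes.H413.F0P3cStCharTSShellVal

variable {R : Type*} [CommRing R] {Γ₀ : Type*} [LinearOrderedCommGroupWithZero Γ₀] (v : Valuation R Γ₀)

/-! ## §1 Ultrametric bookkeeping: products, determinants, matrices `≡ 1 (mod r)` -/

/-- Products are `1`-Lipschitz entrywise for an ultrametric valuation: if `v(aᵢ), v(bᵢ) ≤ 1` and `v(aᵢ − bᵢ) ≤ r` on `s`, then `v(∏ aᵢ − ∏ bᵢ) ≤ r`.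
[folklore] [cite: Casselman1995, Prop. 1.4.4] -/
theorem valuation_prod_sub_prod_le {ι : Type*} [DecidableEq ι] (s : Finset ι) (a b : ι → R) {r : Γ₀}
    (ha : ∀ i ∈ s, v (a i) ≤ 1) (hb : ∀ i ∈ s, v (b i) ≤ 1) (hab : ∀ i ∈ s, v (a i - b i) ≤ r) :
    v (∏ i ∈ s, a i - ∏ i ∈ s, b i) ≤ r := by
  induction s using Finset.induction_on with
  | empty => simp
  | insert j s hj ih =>
    rw [Finset.prod_insert hj, Finset.prod_insert hj,
      show a j * ∏ i ∈ s, a i - b j * ∏ i ∈ s, b i = a j * (∏ i ∈ s, a i - ∏ i ∈ s, b i) + (a j - b j) * ∏ i ∈ s, b i by ring]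
    have h1 : v (a j * (∏ i ∈ s, a i - ∏ i ∈ s, b i)) ≤ r := by
      rw [Valuation.map_mul]
      calc v (a j) * v (∏ i ∈ s, a i - ∏ i ∈ s, b i) ≤ 1 * r :=
            mul_le_mul' (ha j (Finset.mem_insert_self j s))
              (ih (fun i hi => ha i (Finset.mem_insert_of_mem hi)) (fun i hi => hb i (Finset.mem_insert_of_mem hi))
                (fun i hi => hab i (Finset.mem_insert_of_mem hi)))
        _ = r := one_mul r
    have h2 : v ((a j - b j) * ∏ i ∈ s, b i) ≤ r := by
      rw [Valuation.map_mul, map_prod v]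
      calc v (a j - b j) * ∏ i ∈ s, v (b i) ≤ r * 1 :=
            mul_le_mul' (hab j (Finset.mem_insert_self j s)) (Finset.prod_le_one' fun i hi => hb i (Finset.mem_insert_of_mem hi))
        _ = r := mul_one r
    exact Valuation.map_add_le v h1 h2

variable {n : Type*} [Fintype n] [DecidableEq n]

/-- Determinants are `1`-Lipschitz entrywise for an ultrametric valuation: entries of valuation `≤ 1`, entrywise `v(A_{ij} − B_{ij}) ≤ r` ⟹ `v(det A − det B) ≤ r`
(Leibniz expansion). [folklore] [cite: Casselman1995, Prop. 1.4.4] -/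
theorem valuation_det_sub_det_le (A B : Matrix n n R) {r : Γ₀} (hA : ∀ i j, v (A i j) ≤ 1) (hB : ∀ i j, v (B i j) ≤ 1)
    (hAB : ∀ i j, v (A i j - B i j) ≤ r) : v (A.det - B.det) ≤ r := by
  rw [Matrix.det_apply, Matrix.det_apply, ← Finset.sum_sub_distrib]
  refine Valuation.map_sum_le v fun σ _ => ?_
  rw [← smul_sub]
  have hprod : v (∏ i, A (σ i) i - ∏ i, B (σ i) i) ≤ r :=
    valuation_prod_sub_prod_le v Finset.univ (fun i => A (σ i) i) (fun i => B (σ i) i) (fun i _ => hA _ _) (fun i _ => hB _ _)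
      (fun i _ => hAB _ _)
  rcases Int.units_eq_one_or (Equiv.Perm.sign σ) with h | h
  · rw [h, one_smul]
    exact hprod
  · rw [h, Units.smul_def, Units.val_neg, Units.val_one, neg_smul, one_smul, Valuation.map_neg]
    exact hprod

omit [Fintype n] in
/-- The entries of the identity matrix have valuation `≤ 1`. [folklore] -/
theorem valuation_one_apply_le_one (i j : n) : v ((1 : Matrix n n R) i j) ≤ 1 := by
  rw [Matrix.one_apply]
  split_ifs
  · rw [Valuation.map_one]
  · rw [Valuation.map_zero]; exact zero_le

omit [Fintype n] in
/-- A matrix `k ≡ 1 (mod r)`, `r ≤ 1`, has entries of valuation `≤ 1`. [folklore] [cite: Casselman1995, Prop. 1.4.4] -/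
theorem valuation_apply_le_one_of_near_one (k : Matrix n n R) {r : Γ₀} (hr : r ≤ 1)
    (hk : ∀ i j, v (k i j - (1 : Matrix n n R) i j) ≤ r) (i j : n) : v (k i j) ≤ 1 := by
  have h : k i j = (k i j - (1 : Matrix n n R) i j) + (1 : Matrix n n R) i j := by ring
  rw [h]
  exact Valuation.map_add_le v ((hk i j).trans hr) (valuation_one_apply_le_one v i j)

/-- `k ≡ 1 (mod r)` is stable under products (`r ≤ 1`): `(k₁ k₂)_{ij} − δ_{ij} = Σ_l (k₁ − 1)_{il} (k₂)_{lj} + (k₂ − 1)_{ij}`. [folklore] [cite: Casselman1995, Prop. 1.4.4] -/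
theorem near_one_mul (k₁ k₂ : Matrix n n R) {r : Γ₀} (hr : r ≤ 1)
    (hk₁ : ∀ i j, v (k₁ i j - (1 : Matrix n n R) i j) ≤ r) (hk₂ : ∀ i j, v (k₂ i j - (1 : Matrix n n R) i j) ≤ r) (i j : n) :
    v ((k₁ * k₂) i j - (1 : Matrix n n R) i j) ≤ r := by
  have h : (k₁ * k₂) i j - (1 : Matrix n n R) i j = ((k₁ - 1) * k₂) i j + (k₂ - 1) i j := by
    simp only [Matrix.sub_mul, Matrix.one_mul, Matrix.sub_apply]
    ring
  rw [h]
  refine Valuation.map_add_le v ?_ ?_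
  · rw [Matrix.mul_apply]
    refine Valuation.map_sum_le v fun l _ => ?_
    rw [Valuation.map_mul, Matrix.sub_apply]
    calc v (k₁ i l - (1 : Matrix n n R) i l) * v (k₂ l j) ≤ r * 1 :=
          mul_le_mul' (hk₁ i l) (valuation_apply_le_one_of_near_one v k₂ hr hk₂ l j)
      _ = r := mul_one r
  · rw [Matrix.sub_apply]
    exact hk₂ i j

omit [Fintype n] in
/-- `k ≡ 1 (mod r)` passes to principal submatrices along an injective reindexing. [folklore] -/
theorem near_one_submatrix {m : Type*} [DecidableEq m] (k : Matrix n n R) {r : Γ₀}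
    (hk : ∀ i j, v (k i j - (1 : Matrix n n R) i j) ≤ r) (e : m → n) (he : Function.Injective e) (a b : m) :
    v (k.submatrix e e a b - (1 : Matrix m m R) a b) ≤ r := by
  rw [Matrix.submatrix_apply, ← Matrix.submatrix_one e he, Matrix.submatrix_apply]
  exact hk (e a) (e b)

/-- `k ≡ 1 (mod r)`, `r ≤ 1` ⟹ `v(det k − 1) ≤ r`. [folklore] [cite: Casselman1995, Prop. 1.4.4] -/
theorem valuation_det_sub_one_le_of_near_one (k : Matrix n n R) {r : Γ₀} (hr : r ≤ 1)
    (hk : ∀ i j, v (k i j - (1 : Matrix n n R) i j) ≤ r) : v (k.det - 1) ≤ r := by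
  rw [← Matrix.det_one (n := n) (R := R)]
  exact valuation_det_sub_det_le v k 1 (valuation_apply_le_one_of_near_one v k hr hk) (valuation_one_apply_le_one v) hk

/-! ## §2 The shell `x = diag(d) · k`: principal minors and characteristic-polynomial coefficients -/

/-- Principal submatrices of `diag(d) · k`: `(diag(d) · k)_{e,e} = diag(d ∘ e) · k_{e,e}`. [folklore] -/
theorem submatrix_diagonal_mul {m : Type*} [Fintype m] [DecidableEq m] (d : n → R) (k : Matrix n n R) (e : m → n) :
    (Matrix.diagonal d * k).submatrix e e = Matrix.diagonal (d ∘ e) * k.submatrix e e := by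
  ext a b
  simp only [Matrix.submatrix_apply, Matrix.diagonal_mul, Function.comp_apply]

/-- Principal minors of `diag(d) · k`: `det (diag(d) · k)_{e,e} = (∏_a d(e a)) · det k_{e,e}`. [folklore] -/
theorem det_submatrix_diagonal_mul {m : Type*} [Fintype m] [DecidableEq m] (d : n → R) (k : Matrix n n R) (e : m → n) :
    ((Matrix.diagonal d * k).submatrix e e).det = (∏ a, d (e a)) * (k.submatrix e e).det := by
  rw [submatrix_diagonal_mul, Matrix.det_mul, Matrix.det_diagonal]
  rfl

/-- **Principal minors on the shell**: for `k ≡ 1 (mod r)`, `r ≤ 1`, and `s ⊆ n`: `v(det (diag(d) · k)_{s,s} − ∏_{i∈s} d_i) ≤ r · ∏_{i∈s} v(d_i)`.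
[folklore] [cite: Casselman1995, Prop. 1.4.4] -/
theorem valuation_principalMinor_sub_le (d : n → R) (k : Matrix n n R) {r : Γ₀} (hr : r ≤ 1)
    (hk : ∀ i j, v (k i j - (1 : Matrix n n R) i j) ≤ r) (s : Finset n) :
    v (((Matrix.diagonal d * k).submatrix (Subtype.val : ↥s → n) (Subtype.val : ↥s → n)).det - ∏ i ∈ s, d i) ≤ r * ∏ i ∈ s, v (d i) := by
  rw [det_submatrix_diagonal_mul, Finset.prod_coe_sort s d,
    show (∏ i ∈ s, d i) * (k.submatrix (Subtype.val : ↥s → n) (Subtype.val : ↥s → n)).det - ∏ i ∈ s, d i =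
      (∏ i ∈ s, d i) * ((k.submatrix (Subtype.val : ↥s → n) (Subtype.val : ↥s → n)).det - 1) by ring,
    Valuation.map_mul, map_prod v, mul_comm (∏ i ∈ s, v (d i)) _]
  exact mul_le_mul' (valuation_det_sub_one_le_of_near_one v _ hr (near_one_submatrix v k hk Subtype.val Subtype.val_injective))
    le_rfl

/-- The principal minors of `diag(d)` itself: `det (diag d)_{s,s} = ∏_{i∈s} d_i`. [folklore] -/
theorem det_submatrix_diagonal (d : n → R) (s : Finset n) :
    ((Matrix.diagonal d).submatrix (Subtype.val : ↥s → n) (Subtype.val : ↥s → n)).det = ∏ i ∈ s, d i := by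
  rw [← mul_one (Matrix.diagonal d), det_submatrix_diagonal_mul, Matrix.submatrix_one _ Subtype.val_injective, Matrix.det_one, mul_one,
    Finset.prod_coe_sort s d]

/-- **Characteristic-polynomial coefficients on the shell** (relative precision): for `x = diag(d) · k`, `k ≡ 1 (mod r)`, `r ≤ 1`, `j ≤ card n`, and a bound
`M` of the `j`-fold products `∏_{i∈s} v(d_i)` (`|s| = j`): `v(coeff_{card n − j}(charpoly x) − coeff_{card n − j}(charpoly (diag d))) ≤ r · M` — both coefficients are
`(−1)^j Σ_{|s| = j}` (principal minor) (Mathlib `charpoly_coeff_eq_sum_minors`). [folklore] [cite: Casselman1995, Prop. 1.4.4] -/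
theorem valuation_charpoly_coeff_sub_le (d : n → R) (k : Matrix n n R) {r M : Γ₀} (hr : r ≤ 1)
    (hk : ∀ i j, v (k i j - (1 : Matrix n n R) i j) ≤ r) {j : ℕ} (hj : j ≤ Fintype.card n)
    (hM : ∀ s ∈ (Finset.univ : Finset n).powersetCard j, ∏ i ∈ s, v (d i) ≤ M) :
    v ((Matrix.diagonal d * k).charpoly.coeff (Fintype.card n - j) - (Matrix.diagonal d).charpoly.coeff (Fintype.card n - j)) ≤ r * M := by
  rw [Matrix.charpoly_coeff_eq_sum_minors _ j hj, Matrix.charpoly_coeff_eq_sum_minors _ j hj, ← mul_sub, ← Finset.sum_sub_distrib,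
    Valuation.map_mul, Valuation.map_pow, Valuation.map_neg, Valuation.map_one, one_pow, one_mul]
  refine Valuation.map_sum_le v fun s hs => ?_
  rw [det_submatrix_diagonal]
  exact (valuation_principalMinor_sub_le v d k hr hk s).trans (mul_le_mul' le_rfl (hM s hs))

/-- Two-sided shells reduce to one-sided ones: `charpoly (k₁ · diag(d) · k₂) = charpoly (diag(d) · (k₂ k₁))`. [folklore] -/
theorem charpoly_mul_diagonal_mul (d : n → R) (k₁ k₂ : Matrix n n R) :
    (k₁ * Matrix.diagonal d * k₂).charpoly = (Matrix.diagonal d * (k₂ * k₁)).charpoly := by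
  rw [Matrix.mul_assoc, Matrix.charpoly_mul_comm, Matrix.mul_assoc]

/-- **Two-sided form**: for `x = k₁ · diag(d) · k₂` with `k₁, k₂ ≡ 1 (mod r)`, `r ≤ 1`: the same relative-precision estimate.
[folklore] [cite: Casselman1995, Prop. 1.4.4] -/
theorem valuation_charpoly_coeff_sub_le' (d : n → R) (k₁ k₂ : Matrix n n R) {r M : Γ₀} (hr : r ≤ 1)
    (hk₁ : ∀ i j, v (k₁ i j - (1 : Matrix n n R) i j) ≤ r) (hk₂ : ∀ i j, v (k₂ i j - (1 : Matrix n n R) i j) ≤ r)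
    {j : ℕ} (hj : j ≤ Fintype.card n) (hM : ∀ s ∈ (Finset.univ : Finset n).powersetCard j, ∏ i ∈ s, v (d i) ≤ M) :
    v ((k₁ * Matrix.diagonal d * k₂).charpoly.coeff (Fintype.card n - j) - (Matrix.diagonal d).charpoly.coeff (Fintype.card n - j)) ≤ r * M := by
  rw [charpoly_mul_diagonal_mul]
  exact valuation_charpoly_coeff_sub_le v d (k₂ * k₁) hr (near_one_mul v k₂ k₁ hr hk₂ hk₁) hj hM

/-! ## §3 The rank-3 contracting shell: EXACT valuations of the three coefficients -/

/-- The coefficients of `charpoly (diag d)` on `Fin 3`: `X³ − e₁ X² + e₂ X − e₃`. [folklore] -/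
theorem charpoly_diagonal_fin_three_coeff (d : Fin 3 → R) :
    (Matrix.diagonal d).charpoly.coeff 2 = -(d 0 + d 1 + d 2) ∧
      (Matrix.diagonal d).charpoly.coeff 1 = d 0 * d 1 + d 0 * d 2 + d 1 * d 2 ∧
      (Matrix.diagonal d).charpoly.coeff 0 = -(d 0 * d 1 * d 2) := by
  have h : (Matrix.diagonal d).charpoly = (X - C (d 0)) * (X - C (d 1)) * (X - C (d 2)) := by
    rw [Matrix.charpoly_diagonal, Fin.prod_univ_three]
  have h' : (X - C (d 0)) * (X - C (d 1)) * (X - C (d 2)) =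
      X ^ 3 - C (d 0 + d 1 + d 2) * X ^ 2 + C (d 0 * d 1 + d 0 * d 2 + d 1 * d 2) * X - C (d 0 * d 1 * d 2) := by
    simp only [map_add, map_mul]
    ring
  rw [h, h']
  simp only [coeff_sub, coeff_add, coeff_C_mul, coeff_X_pow, coeff_X, coeff_C]
  norm_num

/-- If `v(y − c) < v(c)` then `v(y) = v(c)` (the ultrametric «dominant term» rule). [folklore] -/
theorem valuation_eq_of_sub_lt {y c : R} (h : v (y - c) < v c) : v y = v c := by
  have : y = (y - c) + c := by ring
  rw [this]
  exact Valuation.map_add_eq_of_lt_right v h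

/-- **EXACT VALUATIONS ON THE RANK-3 CONTRACTING SHELL.**  For `x = k₁ · diag(d₀, d₁, d₂) · k₂` with `k₁, k₂ ≡ 1 (mod r)`, `r < 1`, and a STRICT chain
`v(d₀) < v(d₁) < v(d₂)` with `v(d₀) ≠ 0`: `v(coeff₂ charpoly x) = v(d₂)`, `v(coeff₁ charpoly x) = v(d₁ d₂)`, `v(coeff₀ charpoly x) = v(d₀ d₁ d₂)` — the
valuation pattern of the shell `K_n z aᵐ K_n` (`a = d(ϖ, 1, σϖ⁻¹)`, `m ≥ 1`), distinct from that of every class with three eigenvalues of equal valuation.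
[cite: Rogawski1990, §12.7 L. 12.7.3 (proof) p. 195; §4.9 p. 55] [cite: Casselman1995, Prop. 1.4.4, §1.5] -/
theorem valuation_charpoly_coeff_shell_three (d : Fin 3 → R) (k₁ k₂ : Matrix (Fin 3) (Fin 3) R) {r : Γ₀} (hr : r < 1)
    (hk₁ : ∀ i j, v (k₁ i j - (1 : Matrix (Fin 3) (Fin 3) R) i j) ≤ r) (hk₂ : ∀ i j, v (k₂ i j - (1 : Matrix (Fin 3) (Fin 3) R) i j) ≤ r)
    (h0 : v (d 0) ≠ 0) (h01 : v (d 0) < v (d 1)) (h12 : v (d 1) < v (d 2)) :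
    v ((k₁ * Matrix.diagonal d * k₂).charpoly.coeff 2) = v (d 2) ∧
      v ((k₁ * Matrix.diagonal d * k₂).charpoly.coeff 1) = v (d 1) * v (d 2) ∧
      v ((k₁ * Matrix.diagonal d * k₂).charpoly.coeff 0) = v (d 0) * v (d 1) * v (d 2) := by
  obtain ⟨hc2, hc1, hc0⟩ := charpoly_diagonal_fin_three_coeff d
  have h1 : v (d 1) ≠ 0 := ne_of_gt (lt_of_le_of_lt zero_le h01)
  have h2 : v (d 2) ≠ 0 := ne_of_gt (lt_of_le_of_lt zero_le h12)
  have h02 : v (d 0) < v (d 2) := h01.trans h12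
  -- valuations of the elementary symmetric functions of `d` (dominant terms)
  have he1 : v (d 0 + d 1 + d 2) = v (d 2) :=
    Valuation.map_add_eq_of_lt_right v (lt_of_le_of_lt (Valuation.map_add v _ _) (max_lt h02 h12))
  have he2 : v (d 0 * d 1 + d 0 * d 2 + d 1 * d 2) = v (d 1) * v (d 2) := by
    have hlt : v (d 0 * d 1 + d 0 * d 2) < v (d 1 * d 2) := by
      refine lt_of_le_of_lt (Valuation.map_add v _ _) (max_lt ?_ ?_)
      · rw [Valuation.map_mul, Valuation.map_mul, mul_comm (v (d 1)) (v (d 2)), mul_comm (v (d 0)) (v (d 1)), mul_comm (v (d 1)) (v (d 0))]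
        exact mul_lt_mul_of_pos_right h02 (zero_lt_iff.2 h1)
      · rw [Valuation.map_mul, Valuation.map_mul]
        exact mul_lt_mul_of_pos_right h01 (zero_lt_iff.2 h2)
    rw [Valuation.map_add_eq_of_lt_right v hlt, Valuation.map_mul]
  have he3 : v (d 0 * d 1 * d 2) = v (d 0) * v (d 1) * v (d 2) := by rw [Valuation.map_mul, Valuation.map_mul]
  -- the bounds `M_j` on the `j`-fold products
  have hle01 : v (d 0) ≤ v (d 1) := h01.le
  have hle12 : v (d 1) ≤ v (d 2) := h12.le
  have hle02 : v (d 0) ≤ v (d 2) := h02.le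
  have hM1 : ∀ s ∈ (Finset.univ : Finset (Fin 3)).powersetCard 1, ∏ i ∈ s, v (d i) ≤ v (d 2) := by
    intro s hs
    obtain ⟨a, rfl⟩ := Finset.card_eq_one.1 (Finset.mem_powersetCard.1 hs).2
    rw [Finset.prod_singleton]
    fin_cases a
    · exact hle02
    · exact hle12
    · exact le_rfl
  have hM2 : ∀ s ∈ (Finset.univ : Finset (Fin 3)).powersetCard 2, ∏ i ∈ s, v (d i) ≤ v (d 1) * v (d 2) := by
    intro s hs
    obtain ⟨a, b, hab, rfl⟩ := Finset.card_eq_two.1 (Finset.mem_powersetCard.1 hs).2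
    rw [Finset.prod_pair hab]
    fin_cases a <;> fin_cases b
    all_goals first
      | exact absurd rfl hab
      | exact mul_le_mul' hle01 hle12
      | exact mul_le_mul' le_rfl hle02
      | exact mul_le_mul' hle01 le_rfl
      | exact (le_of_eq (mul_comm _ _)).trans (mul_le_mul' hle01 le_rfl)
      | exact le_rfl
      | exact le_of_eq (mul_comm _ _)
  have hM3 : ∀ s ∈ (Finset.univ : Finset (Fin 3)).powersetCard 3, ∏ i ∈ s, v (d i) ≤ v (d 0) * v (d 1) * v (d 2) := by
    intro s hs
    have hs3 : s = Finset.univ := Finset.eq_univ_of_card s (by rw [(Finset.mem_powersetCard.1 hs).2, Fintype.card_fin])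
    subst hs3
    rw [Fin.prod_univ_three]
  -- the relative-precision estimates of §2 at `j = 1, 2, 3`
  have hr1 : r ≤ 1 := hr.le
  have e1 := valuation_charpoly_coeff_sub_le' v d k₁ k₂ hr1 hk₁ hk₂ (j := 1) (by rw [Fintype.card_fin]; norm_num) hM1
  have e2 := valuation_charpoly_coeff_sub_le' v d k₁ k₂ hr1 hk₁ hk₂ (j := 2) (by rw [Fintype.card_fin]; norm_num) hM2
  have e3 := valuation_charpoly_coeff_sub_le' v d k₁ k₂ hr1 hk₁ hk₂ (j := 3) (by rw [Fintype.card_fin]) hM3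
  simp only [Fintype.card_fin, show 3 - 1 = 2 from rfl, show 3 - 2 = 1 from rfl, Nat.sub_self] at e1 e2 e3
  rw [hc2] at e1
  rw [hc1] at e2
  rw [hc0] at e3
  -- `r · M_j < M_j = v(e_j)`: the dominant-term rule gives the exact valuations
  have hv2 : v (-(d 0 + d 1 + d 2)) = v (d 2) := by rw [Valuation.map_neg, he1]
  have hv1 : v (d 0 * d 1 + d 0 * d 2 + d 1 * d 2) = v (d 1) * v (d 2) := he2
  have hv0 : v (-(d 0 * d 1 * d 2)) = v (d 0) * v (d 1) * v (d 2) := by rw [Valuation.map_neg, he3]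
  have hne2 : v (d 2) ≠ 0 := h2
  have hne12 : v (d 1) * v (d 2) ≠ 0 := mul_ne_zero h1 h2
  have hne012 : v (d 0) * v (d 1) * v (d 2) ≠ 0 := mul_ne_zero (mul_ne_zero h0 h1) h2
  refine ⟨?_, ?_, ?_⟩
  · rw [← hv2]
    refine valuation_eq_of_sub_lt v (lt_of_le_of_lt e1 ?_)
    rw [hv2]
    calc r * v (d 2) < 1 * v (d 2) := mul_lt_mul_of_pos_right hr (zero_lt_iff.2 hne2)
      _ = v (d 2) := one_mul _
  · rw [← hv1]
    refine valuation_eq_of_sub_lt v (lt_of_le_of_lt e2 ?_)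
    rw [hv1]
    calc r * (v (d 1) * v (d 2)) < 1 * (v (d 1) * v (d 2)) := mul_lt_mul_of_pos_right hr (zero_lt_iff.2 hne12)
      _ = v (d 1) * v (d 2) := one_mul _
  · rw [← hv0]
    refine valuation_eq_of_sub_lt v (lt_of_le_of_lt e3 ?_)
    rw [hv0]
    calc r * (v (d 0) * v (d 1) * v (d 2)) < 1 * (v (d 0) * v (d 1) * v (d 2)) := mul_lt_mul_of_pos_right hr (zero_lt_iff.2 hne012)
      _ = v (d 0) * v (d 1) * v (d 2) := one_mul _

end Summit.HodgeConjecture.HodgeConjecture.Cruxes.H413.F0P3cStCharTSShellVal
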